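import Literature.MathematicalPhysics.QuantumFieldTheory.Balaban1983to89.B5Strip145Decay

/-!
# `BalabanUV.Beta.FP.SliceProjectorMidInv` — road «FP» (binder row D1), organisation γ, row GAMMA-3 (a): **THE INVERSE SYMBOL OF
# `Mid = Q′Δ⁻²Q′ᵀ` IS STRIP-REGULAR, n-UNIFORMLY, AND ITS COARSE LATTICE KERNEL DECAYS EXPONENTIALLY** —
# `yInv n p := Δ^ξ(p)²/𝒩(p)` (`= (Σ_l |u(p′+l)|²/Δ(p′+l)²)⁻¹` off the zero set of `Δ^ξ`; no `1/Δ^ξ` anywhere),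
# `StripRegular (yInv n) κ_Y C_Y` and `‖latticeKernel (yInv n) x‖ ≤ C_Y·e^{−κ_Y‖x‖∞}` for EVERY `n ≥ 1` (`κ_Y`, `C_Y` depend on the dimension only)

HONEST FRAMING (cell contract, verbatim): «discharging `BetaPertH` makes Bałaban's UV stability UNCONDITIONAL — a real constructive-QFT
result; it is NOT the continuum limit and NOT the Clay problem.»  HONEST DEPENDENCY (verbatim): «continuum YM on T⁴ ⇐ BetaPertH ∧ nine
spine estimates (0/9 proved); BetaPertH ⇐ (D1) ∧ (D4) ∧ CAP+tail; G-an2-4 gates asym, D1 and NE2/3/4.»  THIS MODULE DISCHARGES NOTHING of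
D1 ∕ BetaPertH: [folklore] assembly over the tree's B4∕B5 strip modules BY NAME — `B5Strip145.Ncal`∕`Ncal_lower_of_ImLipschitz`∕`Ncal_re_ge`,
`B5Strip145Leaves.imLipschitzN_holds`∕`norm_Ncal_le_strip`∕`LambdaN`, `B5Strip145Analytic.differentiableAt_Ncal`∕`differentiableAt_DeltaXi`∕`Ncal_tr`∕
`Yfac`∕`re_DeltaXi_pos_of_edge`∕`kappa_small`, `B5Strip145Decay.differentiableAt_insertNth`∕`tr_insertNth_left`∕`insertNth_left_mem`,
`B4StripCauchy.norm_DeltaXi_le`, `B4ContourShift.latticeKernel_decay`.  ONE [our object] def (`yInv`) + two CONSTANT defs (`kapY`, `CY`,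
dimension-only); no `def … : Prop`; nothing is cited; 0 sorry.  NOT summit progress; NOT hbook, NOT D1, NOT BetaPertH, NOT continuum, NOT Clay.

ABSOLUTE RULE (cell, verbatim): «No internally-minted statement may enter as a cited fact. Every hypothesis is either kernel-proved in this
package or a verbatim quotation of a PUBLISHED theorem with page reference. The manuscript(s) under audit are NOT citable for their own
disputed steps — they are the thing under adjudication; programme-internal (2001/route/tribunal) claims are never citable.»

WHY (owner design memo `HOME/b2b-balaban-beta-d1-p3/GAMMA-DESIGN.md` §3, row GAMMA-3 «`(1−Π)`, `Mid⁻¹` … as strip-regular alias-sum symbols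
(l = 0 cancellation displayed) ⟹ exp-local kernels»; INTENT journal l.24538).  `Mid(k) = Σ_l |q′(k_l)|²/Δ(k_l)²` is, up to the power of `n`
fixed by the normalisation of `Q′`, B5 (1.45)'s alias sum `Yfac n k = Σ_l U n l k / Δ^ξ(k + 2πl)²` (`|q′(k_l)|² = U n l k`, `Δ(k_l) = Δ^ξ(k+2πl)/n²`),
and the «l = 0 cancellation» is the tree's regrouping `𝒩 = U₀ + (Δ^ξ)²·X_{≠0}` (`Ncal_eq_DeltaXi_sq_mul_Yfac`): `1/Yfac = (Δ^ξ)²/𝒩` has no pole on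
the strip because `𝒩` is bounded below there, n-uniformly (real positivity `𝒩 ≥ (4/π²)^D` + the Im-Lipschitz bound of the ENTIRE `𝒩`).
The (dimensionless) coarse kernel of `Mid⁻¹` is `latticeKernel (yInv n)`; in fine units `u = nU + a` the owner's `Mid⁻¹(u,u′)` is `n^{s}·K[yInv](U − U′)`
with `s` fixed by the normalisation of `Q′` (mean: the coarse symbol of `Q′Δ⁻²Q′ᵀ` is `n^{4−D}·Yfac`) — the decay `e^{−κ_Y|U−U′|} = e^{−κ_Y|u−u′|/n}`.

CONTENT.
* §1 `yInv`, `yInv_eq_inv_Yfac`, `kapY` (`κ_Y := min r (c_N/(Λ_N d + 1))`, `c_N = ½(4/π²)^d`), **`Ncal_lower`** (`c_N ≤ ‖𝒩‖` on `Strip d κ_Y`, all `n ≥ 1`),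
  `CY`, `norm_yInv_le`.
* §2 `yInv_tr` (shift law ⟹ `yInv` IS `2π`-periodic off the bad set), `yInv_periodic_side`, `differentiableAt_yInv`.
* §3 **`stripRegular_yInv`**, **`norm_latticeKernel_yInv_le`** (+ Euclidean form).
Unit `b2b-balaban-beta-d1-formalise-leaf-06` (gen 8), organisation γ (owner ruling R-FP-25), row GAMMA-3 (a).
-/

noncomputable section

namespace Summit.QuantumFields.BalabanUV.Beta.FP.SliceProjectorMidInv

open Complex Set
open Literature.MathematicalPhysics.QuantumFieldTheory.Balaban1983to89
open B4Strip (Strip ofRealVec reVec DeltaXi U shift)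
open B4StripCauchy (Fat strip_subset_fat norm_DeltaXi_le rOf rOf_pos rOf_le d_mul_rOf_sq_le)
open B5Strip145 (Ncal Xne Ncal_lower_of_ImLipschitz Ncal_re_ge)
open B5Strip145Leaves (boundN LambdaN LambdaN_nonneg imLipschitzN_holds norm_Ncal_le_strip)
open B5Strip145Analytic (Yfac tr tr_def Ncal_eq_DeltaXi_sq_mul_Yfac Ncal_tr differentiableAt_Ncal differentiableAt_DeltaXi
  re_DeltaXi_pos_of_edge kappa_small tr_im tr_re_self tr_apply_self strip_mono)
open B5Strip145Decay (differentiableAt_insertNth tr_insertNth_left insertNth_left_mem)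
open B4ContourShift (BZ StripRegular latticeKernel supNorm latticeKernel_decay latticeKernel_decay_euclid insertNth_mem_Strip
  openRect_subset_closedRect)
open scoped Real

variable {d : ℕ}

/-! ## §1 The inverse symbol and the n-uniform lower bound of `𝒩` -/

/-- [our object] **THE (dimensionless) INVERSE SYMBOL OF `Mid = Q′Δ⁻²Q′ᵀ`**: `yInv n p := Δ^ξ(p)² / 𝒩(p)` — the regrouped form of
`(Σ_l |u(p+2πl)|²/Δ^ξ(p+2πl)²)⁻¹` with no `1/Δ^ξ(p)` (the l = 0 singularities cancel). -/
def yInv (n : ℕ) [NeZero n] (p : Fin d → ℂ) : ℂ := DeltaXi n 0 p ^ 2 / Ncal n p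

/-- [folklore] THE DICTIONARY: off the zero set of `Δ^ξ` and `𝒩`, `yInv = 1/Yfac = (Σ_l U_l/Δ^ξ(·+2πl)²)⁻¹`. -/
theorem yInv_eq_inv_Yfac (n : ℕ) [NeZero n] {p : Fin d → ℂ} (h0 : DeltaXi n 0 p ≠ 0) :
    yInv n p = (Yfac n p)⁻¹ := by
  have hY : Yfac n p = Ncal n p / DeltaXi n 0 p ^ 2 := by
    rw [Ncal_eq_DeltaXi_sq_mul_Yfac n p h0]; field_simp
  rw [yInv, hY, inv_div]

/-- [our object] the strip half-width `κ_Y := min r (c_N/(Λ_N·d + 1))`, `r = rOf d`, `c_N = ½(4/π²)^d`, `Λ_N = LambdaN d` (dimension only). -/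
def kapY (d : ℕ) : ℝ := min (rOf d) ((4 / Real.pi ^ 2) ^ d / 2 / (LambdaN d * d + 1))

/-- [folklore] `0 < κ_Y ≤ r`. -/
theorem kapY_pos (d : ℕ) : 0 < kapY d := by
  unfold kapY
  have h1 := LambdaN_nonneg d
  exact lt_min (rOf_pos d) (by positivity)

/-- [folklore] `κ_Y ≤ r`. -/
theorem kapY_le_rOf (d : ℕ) : kapY d ≤ rOf d := min_le_left _ _

/-- [folklore] **THE n-UNIFORM LOWER BOUND OF THE REGROUPED NUMERATOR ON THE STRIP**: `½(4/π²)^d ≤ ‖𝒩_n(p)‖` for `p ∈ Strip d κ_Y`, every `n ≥ 1`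
(the tree's `Ncal_lower_of_ImLipschitz` + `imLipschitzN_holds` + `smallness_aux`, assembled). -/
theorem Ncal_lower (n : ℕ) [NeZero n] : ∀ p ∈ Strip d (kapY d), (4 / Real.pi ^ 2) ^ d / 2 ≤ ‖Ncal n p‖ := by
  have hn : 1 ≤ n := Nat.one_le_iff_ne_zero.mpr (NeZero.ne n)
  have hκ0 := (kapY_pos d).le
  refine Ncal_lower_of_ImLipschitz n hn (kapY d) (LambdaN d) (LambdaN_nonneg d) (imLipschitzN_holds n hκ0 (kapY_le_rOf d)) ?_
  exact B5Strip145.smallness_aux (LambdaN d) _ (kapY d) d (LambdaN_nonneg d) (by positivity) (min_le_right _ _)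

/-- [folklore] hence `𝒩 ≠ 0` on the strip. -/
theorem Ncal_ne_zero (n : ℕ) [NeZero n] {p : Fin d → ℂ} (hp : p ∈ Strip d (kapY d)) : Ncal n p ≠ 0 := by
  intro h
  have h1 := Ncal_lower n p hp
  rw [h, norm_zero] at h1
  have : (0 : ℝ) < (4 / Real.pi ^ 2) ^ d / 2 := by positivity
  linarith

/-- [our object] the bound constant `C_Y := (16 d)²/(½(4/π²)^d)` (dimension only). -/
def CY (d : ℕ) : ℝ := (16 * (d : ℝ)) ^ 2 / ((4 / Real.pi ^ 2) ^ d / 2)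

/-- [folklore] `0 ≤ C_Y`. -/
theorem CY_nonneg (d : ℕ) : 0 ≤ CY d := by unfold CY; positivity

/-- [folklore] **`‖yInv n p‖ ≤ C_Y` ON THE STRIP**, every `n ≥ 1` (`‖Δ^ξ‖ ≤ 16d` on the fat region, `‖𝒩‖ ≥ c_N`). -/
theorem norm_yInv_le (n : ℕ) [NeZero n] {p : Fin d → ℂ} (hp : p ∈ Strip d (kapY d)) : ‖yInv n p‖ ≤ CY d := by
  have hn : 1 ≤ n := Nat.one_le_iff_ne_zero.mpr (NeZero.ne n)
  have hfat : p ∈ Fat d (rOf d) := strip_subset_fat (rOf_pos d).le (kapY_le_rOf d) hp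
  have hΔ : ‖DeltaXi n 0 p‖ ≤ 16 * d := by
    have h := norm_DeltaXi_le n hn 0 le_rfl (rOf_le d) hfat
    linarith
  have hN := Ncal_lower n p hp
  have hc : (0 : ℝ) < (4 / Real.pi ^ 2) ^ d / 2 := by positivity
  rw [yInv, norm_div, norm_pow]
  rw [div_le_iff₀ (lt_of_lt_of_le hc hN), CY]
  calc ‖DeltaXi n 0 p‖ ^ 2 ≤ (16 * (d : ℝ)) ^ 2 := pow_le_pow_left₀ (norm_nonneg _) hΔ 2
    _ = (16 * (d : ℝ)) ^ 2 / ((4 / Real.pi ^ 2) ^ d / 2) * ((4 / Real.pi ^ 2) ^ d / 2) := by field_simp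
    _ ≤ (16 * (d : ℝ)) ^ 2 / ((4 / Real.pi ^ 2) ^ d / 2) * ‖Ncal n p‖ := mul_le_mul_of_nonneg_left hN (by positivity)

/-! ## §2 Periodicity across the sides and holomorphy -/

/-- [folklore] **THE SHIFT LAW MAKES `yInv` PERIODIC**: `yInv n (p + 2π e_μ) = yInv n p` whenever `p_μ ∉ {0, −2π}`, `Δ^ξ(p) ≠ 0`,
`Δ^ξ(p + 2πe_μ) ≠ 0`, `𝒩(p) ≠ 0`, `𝒩(p + 2πe_μ) ≠ 0` (from `Ncal_tr`: `𝒩(p+2πe_μ)·Δ^ξ(p)² = Δ^ξ(p+2πe_μ)²·𝒩(p)`). -/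
theorem yInv_tr (n : ℕ) [NeZero n] (p : Fin d → ℂ) (μ : Fin d) (hz : p μ ≠ 0) (hz' : p μ + 2 * Real.pi ≠ 0)
    (h0 : DeltaXi n 0 p ≠ 0) (h1 : DeltaXi n 0 (tr p μ) ≠ 0) (hN0 : Ncal n p ≠ 0) (hN1 : Ncal n (tr p μ) ≠ 0) :
    yInv n (tr p μ) = yInv n p := by
  have h := Ncal_tr n p μ hz hz' h0 h1
  rw [yInv, yInv, div_eq_div_iff hN1 hN0]
  linear_combination -h

/-- [folklore] **PERIODICITY ACROSS THE STRIP SIDES**: for `p ∈ Strip d κ_Y` with `Re p_μ = −π`, `yInv n (p + 2πe_μ) = yInv n p`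
(the four side conditions hold there: `re_DeltaXi_pos_of_edge`, and `𝒩 ≠ 0` on the strip at both points). -/
theorem yInv_periodic_side (n : ℕ) [NeZero n] {p : Fin d → ℂ} (hp : p ∈ Strip d (kapY d)) (μ : Fin d)
    (hre : (p μ).re = -Real.pi) : yInv n (tr p μ) = yInv n p := by
  obtain ⟨hκ1, hdκ⟩ := kappa_small (kapY_pos d).le (kapY_le_rOf d)
  have hπ := Real.pi_pos
  have hz : p μ ≠ 0 := by
    intro h; rw [h, Complex.zero_re] at hre; linarith
  have hz' : p μ + 2 * Real.pi ≠ 0 := by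
    intro h
    have := congrArg Complex.re h
    rw [← tr_apply_self, tr_re_self, hre, Complex.zero_re] at this
    linarith
  have h0 : DeltaXi n 0 p ≠ 0 := by
    intro h
    have := re_DeltaXi_pos_of_edge n 0 le_rfl hκ1 hdκ (fun ν => (hp ν).2) μ (by rw [hre, abs_neg, abs_of_pos hπ])
    rw [h, Complex.zero_re] at this
    linarith
  have htr : tr p μ ∈ Strip d (kapY d) := fun ν => by
    refine ⟨?_, by rw [tr_im]; exact (hp ν).2⟩
    by_cases hν : ν = μ
    · subst hν; rw [tr_re_self, hre]; ring_nf; rw [abs_of_pos hπ]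
    · rw [B5Strip145Analytic.tr_apply_of_ne hν]; exact (hp ν).1
  have h1 : DeltaXi n 0 (tr p μ) ≠ 0 := by
    intro h
    have := re_DeltaXi_pos_of_edge n 0 le_rfl hκ1 hdκ (q := tr p μ)
      (fun ν => by rw [tr_im]; exact (hp ν).2) μ (by rw [tr_re_self, hre]; ring_nf; exact abs_of_pos hπ)
    rw [h, Complex.zero_re] at this
    linarith
  exact yInv_tr n p μ hz hz' h0 h1 (Ncal_ne_zero n hp) (Ncal_ne_zero n htr)

/-- [folklore] `yInv n` is holomorphic (jointly) at every point of the strip `Strip d κ_Y` (both factors holomorphic on the fat region, `𝒩 ≠ 0`). -/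
theorem differentiableAt_yInv (n : ℕ) [NeZero n] {p : Fin d → ℂ} (hp : p ∈ Strip d (kapY d)) : DifferentiableAt ℂ (yInv n) p := by
  have hfat : p ∈ Fat d (rOf d) := strip_subset_fat (rOf_pos d).le (kapY_le_rOf d) hp
  have h1 : DifferentiableAt ℂ (Ncal n) p := differentiableAt_Ncal n (rOf_le d) (d_mul_rOf_sq_le d) hfat
  have h2 : DifferentiableAt ℂ (fun q => DeltaXi n 0 q ^ 2) p := (differentiableAt_DeltaXi n 0 p).pow 2
  show DifferentiableAt ℂ (fun q => DeltaXi n 0 q ^ 2 / Ncal n q) p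
  exact B5Strip145Analytic.dAt_div h2 h1 (Ncal_ne_zero n hp)

/-! ## §3 Strip regularity and the decay of the coarse lattice kernel -/

/-- [our object] **THE INVERSE SYMBOL OF `Mid` IS STRIP-REGULAR, n-UNIFORMLY**: `StripRegular (yInv n) κ_Y C_Y` on `ℂ^{d+1}`, every `n ≥ 1`. -/
theorem stripRegular_yInv (n : ℕ) [NeZero n] :
    StripRegular (d := d) (fun p : Fin (d + 1) → ℂ => yInv n p) (kapY (d + 1)) (CY (d + 1)) := by
  have hκ0 := (kapY_pos (d + 1)).le
  refine ⟨fun p hp => (differentiableAt_yInv n hp).continuousAt.continuousWithinAt, ?_, ?_, fun p hp => norm_yInv_le n hp⟩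
  · intro i q hq z hz
    have hP : i.insertNth z (ofRealVec q) ∈ Strip (d + 1) (kapY (d + 1)) := insertNth_mem_Strip hκ0 i hq (openRect_subset_closedRect _ hz)
    exact ((differentiableAt_yInv n hP).comp z (differentiableAt_insertNth i _ z)).differentiableWithinAt
  · intro i q hq y hy
    obtain ⟨hP, hre⟩ := insertNth_left_mem hκ0 i hq hy
    rw [← tr_insertNth_left]
    exact (yInv_periodic_side n hP i hre).symm

/-- [our object] **THE COARSE LATTICE KERNEL OF `Mid⁻¹` DECAYS EXPONENTIALLY, n-UNIFORMLY**:
`‖latticeKernel (yInv n) x‖ ≤ C_Y·e^{−κ_Y‖x‖∞}` for every `n ≥ 1` and `x ∈ ℤ^{d+1}` (in fine units `u = nU + a`: decay `e^{−κ_Y|u−u′|/n}`). -/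
theorem norm_latticeKernel_yInv_le (n : ℕ) [NeZero n] (x : Fin (d + 1) → ℤ) :
    ‖latticeKernel (fun p : Fin (d + 1) → ℂ => yInv n p) x‖ ≤ CY (d + 1) * Real.exp (-(kapY (d + 1) * supNorm x)) :=
  latticeKernel_decay (stripRegular_yInv n) (kapY_pos (d + 1)).le x

/-- [folklore] the Euclidean form: `‖latticeKernel (yInv n) x‖ ≤ C_Y·e^{−(κ_Y/√(d+1))·|x|₂}`. -/
theorem norm_latticeKernel_yInv_le_euclid (n : ℕ) [NeZero n] (x : Fin (d + 1) → ℤ) :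
    ‖latticeKernel (fun p : Fin (d + 1) → ℂ => yInv n p) x‖
      ≤ CY (d + 1) * Real.exp (-(kapY (d + 1) / Real.sqrt (d + 1) * Real.sqrt (∑ i, ((x i : ℝ)) ^ 2))) :=
  latticeKernel_decay_euclid (stripRegular_yInv n) (kapY_pos (d + 1)).le (CY_nonneg (d + 1)) x

/-- [folklore] on the REAL zone (off `0`) the symbol is the honest inverse of the alias sum: `yInv n s = (Σ_l U_l(s)/Δ^ξ(s+2πl)²)⁻¹`. -/
theorem yInv_ofRealVec_eq (n : ℕ) [NeZero n] {s : Fin d → ℝ} (hs : s ∈ BZ d) (hs0 : s ≠ 0) :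
    yInv n (ofRealVec s) = (Yfac n (ofRealVec s))⁻¹ := by
  have hn : 1 ≤ n := Nat.one_le_iff_ne_zero.mpr (NeZero.ne n)
  have hsπ : ∀ μ, |s μ| ≤ Real.pi := fun μ => by
    unfold BZ at hs; rw [Set.mem_Icc] at hs; exact abs_le.mpr ⟨hs.1 μ, hs.2 μ⟩
  have hN : Ncal n (ofRealVec s) ≠ 0 := by
    intro h
    have h1 := Ncal_re_ge n hn s hsπ
    rw [h, norm_zero] at h1
    have : (0 : ℝ) < (4 / Real.pi ^ 2) ^ d := by positivity
    linarith
  have h0 : DeltaXi n 0 (ofRealVec s) ≠ 0 := by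
    rw [B4Strip.DeltaXi_ofReal]
    obtain ⟨μ, hμ⟩ : ∃ μ, s μ ≠ 0 := by
      by_contra h; push Not at h; exact hs0 (funext h)
    have hpos : 0 < B4Strip.DeltaXir n 0 s := by
      unfold B4Strip.DeltaXir
      have h1 : 0 < B4Strip.Sxir n (s μ) := B4Strip.Sxir_pos n hn (s μ) hμ (hsπ μ)
      have h2 : B4Strip.Sxir n (s μ) ≤ ∑ ν, B4Strip.Sxir n (s ν) :=
        Finset.single_le_sum (f := fun ν => B4Strip.Sxir n (s ν)) (fun ν _ => B4Strip.Sxir_nonneg n (s ν)) (Finset.mem_univ μ)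
      linarith
    exact_mod_cast hpos.ne'
  exact yInv_eq_inv_Yfac n h0

end Summit.QuantumFields.BalabanUV.Beta.FP.SliceProjectorMidInv

end
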